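import Mathlib
import HarnessLib
import Summits.FinalStateConjecture.Statement
import Literature.Geometry.Lorentzian.LandauLifshitzPseudotensor
import Literature.Barriers.FinalStateConjecture.KleinGordonSuperradiantInstabilityInputs
import Summits.FinalStateConjecture.FinalStateConjecture.Theorems.EIHFluxBalanceInertialRecessionStubWindowChargesTransport

/-!
# Crux `InertialRecession`, line `sublinear-is-free-clean-window-charges`: stub `stub_windowCharges`

K3 · WINDOW CHARGES, quantitative. Granted the Landau–Lifshitz pseudotensor bound
`|det g · t^{μν}_LL| ≤ C ‖∂g‖²` (hypothesis; stub `stub_pseudotensorBound` of the line), for smooth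
symmetric Ricci-flat components `g` on an open `W ⊆ E4` and `C¹` moving coordinate spheres
`S_t = {x⁰ = t, |y − c(t)| = R(t)} ⊆ W`, `t ∈ [t₁, t₂]`, `0 < t₁`, with `‖ċ‖, |Ṙ| ≤ 2`, `R ≥ 1`,
`‖g − η‖ ≤ 1/2` and `‖Dg‖ ≤ b(t)` on `S_t` (`b` continuous), the Landau–Lifshitz quasi-local momenta
(`LandauLifshitz.quasiLocalMomentum`, LL (96.16)) obey
`|P^μ(t₂) − P^μ(t₁)| ≤ C' ∫_{t₁}^{t₂} R² b²` with a universal `C'`.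

Proof (Landau–Lifshitz §96, (96.10)–(96.16), for a MOVING sphere): in polar form
`P(t) = κ R² Q(t)` (`…Sphere`), `Q` is differentiable under the integral sign (`…Moving`), and by
the transport theorem (`…Transport`: time derivative of the momentum density = minus flux density
plus a curl, spatial divergence = density, closed-surface Stokes `…Stokes`)
`dP/dt = κ R² ∫ [(Ṙ + ċ·α) emComplex^{μ0} − Σ_j emComplex^{μj} α_j] dτ`; in vacuum
`emComplex = −det g · t_LL` is bounded by `C b²` (`…Pointwise` + the hypothesis), `|Ṙ + ċ·α| ≤ 8`,
so `|dP/dt| ≤ 11 κ τ(S²) C · R² b²`, which integrates (fencing lemma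
`image_norm_le_of_norm_deriv_right_le_deriv_boundary`) to the claim.
-/

noncomputable section

open Set Filter Metric MeasureTheory MeasureTheory.Measure
open scoped Topology

namespace Summit.FinalStateConjecture.FinalStateConjecture.Theorems.SublinearIsFree.WindowCharges

open Literature.Geometry.Lorentzian Literature.Geometry.Lorentzian.LandauLifshitz

/-! ### Elementary bounds -/

/-- Coordinates are bounded by the Euclidean norm: `|v_k| ≤ ‖v‖` on `E3`. [folklore] -/
@[deprecated Literature.Barriers.FinalStateConjecture.abs_apply_le_norm_E3 (since := "2026-08-17")]
alias abs_apply_le_norm_E3 := Literature.Barriers.FinalStateConjecture.abs_apply_le_norm_E3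

/-- **Pointwise bound of the transport integrand**: if `|E_ν| ≤ C b²` for all `ν`, `|r| ≤ 2`,
`‖a‖ ≤ 2` and `α` is a unit vector, then
`|(r + a·α) E_0 − Σ_j E_{j+1} α_j| ≤ 11 C b²`. [folklore] -/
theorem abs_transport_integrand_le {E : Fin 4 → ℝ} {C b r : ℝ} {a : E3} (hC : 0 ≤ C)
    (hE : ∀ ν, |E ν| ≤ C * b ^ 2) (hr : |r| ≤ 2) (ha : ‖a‖ ≤ 2) (α : sphere (0 : E3) 1) :
    |(r + ∑ k : Fin 3, a k * (α : E3) k) * E 0 - ∑ j : Fin 3, E j.succ * (α : E3) j| ≤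
      11 * C * b ^ 2 := by
  have hα : ∀ k, |(α : E3) k| ≤ 1 := abs_coe_unitSphere_apply_le α
  have hak : ∀ k, |a k * (α : E3) k| ≤ 2 := fun k ↦ by
    rw [abs_mul]
    calc |a k| * |(α : E3) k| ≤ 2 * 1 :=
          mul_le_mul ((Literature.Barriers.FinalStateConjecture.abs_apply_le_norm_E3 a k).trans ha) (hα k) (abs_nonneg _) zero_le_two
      _ = 2 := by ring
  have hs : |r + ∑ k : Fin 3, a k * (α : E3) k| ≤ 8 := by
    refine (abs_add_le _ _).trans ?_
    have := (Finset.abs_sum_le_sum_abs (fun k : Fin 3 ↦ a k * (α : E3) k) Finset.univ).trans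
      (Finset.sum_le_sum fun k _ ↦ hak k)
    simp only [Finset.sum_const, Finset.card_univ, Fintype.card_fin, nsmul_eq_mul,
      Nat.cast_ofNat] at this
    linarith
  have hEj : ∀ j : Fin 3, |E j.succ * (α : E3) j| ≤ C * b ^ 2 := fun j ↦ by
    rw [abs_mul]
    calc |E j.succ| * |(α : E3) j| ≤ C * b ^ 2 * 1 :=
          mul_le_mul (hE _) (hα j) (abs_nonneg _) (by positivity)
      _ = C * b ^ 2 := mul_one _
  have h2 : |∑ j : Fin 3, E j.succ * (α : E3) j| ≤ 3 * (C * b ^ 2) := by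
    have := (Finset.abs_sum_le_sum_abs (fun j : Fin 3 ↦ E j.succ * (α : E3) j)
      Finset.univ).trans (Finset.sum_le_sum fun j _ ↦ hEj j)
    simp only [Finset.sum_const, Finset.card_univ, Fintype.card_fin, nsmul_eq_mul,
      Nat.cast_ofNat] at this
    exact this
  have h1 : |(r + ∑ k : Fin 3, a k * (α : E3) k) * E 0| ≤ 8 * (C * b ^ 2) := by
    rw [abs_mul]
    exact mul_le_mul hs (hE 0) (abs_nonneg _) (by norm_num)
  calc _ ≤ |(r + ∑ k : Fin 3, a k * (α : E3) k) * E 0| + |∑ j : Fin 3, E j.succ * (α : E3) j| :=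
        abs_sub _ _
    _ ≤ 8 * (C * b ^ 2) + 3 * (C * b ^ 2) := add_le_add h1 h2
    _ = 11 * C * b ^ 2 := by ring

/-! ### The set of good times is open -/

/-- **Spheres inside an open set stay inside for nearby times** (tube lemma over the compact unit
sphere): for continuous `c`, `R` and open `W`, the set of `t` with `R(t) > 0` and
`(t, c(t) + R(t)α) ∈ W` for all unit `α` is open. [folklore] -/
theorem isOpen_setOf_sphere_subset {W : Set E4} (hW : IsOpen W) {c : ℝ → E3} {R : ℝ → ℝ}
    (hc : Continuous c) (hR : Continuous R) :
    IsOpen {t : ℝ | 0 < R t ∧ ∀ α : sphere (0 : E3) 1,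
      E4.ofTimeSpace t (c t + R t • (α : E3)) ∈ W} := by
  have hpt := continuous_moving_point hc hR
  refine (isOpen_lt continuous_const hR).inter ?_
  rw [isOpen_iff_mem_nhds]
  intro t₀ ht₀
  have h := (isCompact_univ (X := sphere (0 : E3) 1)).eventually_forall_of_forall_eventually
    (x₀ := t₀) (P := fun t α ↦ E4.ofTimeSpace t (c t + R t • (α : E3)) ∈ W) fun α _ ↦
      hpt.continuousAt.preimage_mem_nhds (hW.mem_nhds (ht₀ α))
  exact h.mono fun t ht α ↦ ht α (mem_univ α)

/-! ### The stub -/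

/-- **K3 · WINDOW CHARGES, quantitative** (stub `stub_windowCharges` of the line
`sublinear-is-free-clean-window-charges`, finite-horizon form r3). Granted the pseudotensor bound,
along `C¹` moving vacuum coordinate spheres on `[t₁, t₂]` with speeds `≤ 2`, `R ≥ 1`,
`‖g − η‖ ≤ 1/2` and `‖Dg‖ ≤ b`, the Landau–Lifshitz quasi-local momenta satisfy
`|P^μ(t₂) − P^μ(t₁)| ≤ C ∫_{t₁}^{t₂} R² b²` (LL §96 (96.10)–(96.16); transport theorem for the flux
of `h^{μ0j}` through the moving closed surface, closed-surface Stokes, `(−g)(T + t) = (−g)t` in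
vacuum, area `∝ R²`). [cite: LandauLifshitz1975, §96 (96.16)] -/
theorem stub_windowCharges :
    (∃ C : ℝ, 0 ≤ C ∧ ∀ (g : E4 → E4 →L[ℝ] E4 →L[ℝ] ℝ) (x : E4) (b : ℝ), ContDiffAt ℝ 2 g x → (∀ᶠ y in 𝓝 x, ∀ v w : E4, g y v w = g y w v) → ‖g x - Minkowski.bilin‖ ≤ 1 / 2 → (∀ v : E4, ‖fderiv ℝ g x v‖ ≤ b * ‖v‖) → ∀ μ ν : Fin 4, |LandauLifshitz.metricDet g x * LandauLifshitz.pseudotensor g x μ ν| ≤ C * b ^ 2) →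
    (∃ C : ℝ, ∀ (g : E4 → E4 →L[ℝ] E4 →L[ℝ] ℝ) (W : Set E4) (c : ℝ → E3) (R b : ℝ → ℝ) (t₁ t₂ : ℝ), IsOpen W → ContDiffOn ℝ (⊤ : ℕ∞) g W → (∀ x ∈ W, ∀ v w : E4, g x v w = g x w v) → (∀ x ∈ W, MetricCoord.ricAt g x = 0) → 0 < t₁ → t₁ ≤ t₂ → ContDiff ℝ 1 c → ContDiff ℝ 1 R → ContinuousOn b (Set.Icc t₁ t₂) → (∀ t ∈ Set.Icc t₁ t₂, ‖deriv c t‖ ≤ 2 ∧ |deriv R t| ≤ 2 ∧ 1 ≤ R t) → (∀ t ∈ Set.Icc t₁ t₂, ∀ y ∈ Metric.sphere (c t) (R t), E4.ofTimeSpace t y ∈ W ∧ ‖g (E4.ofTimeSpace t y) - Minkowski.bilin‖ ≤ 1 / 2 ∧ ∀ v : E4, ‖fderiv ℝ g (E4.ofTimeSpace t y) v‖ ≤ b t * ‖v‖) → ∀ μ : Fin 4, |LandauLifshitz.quasiLocalMomentum g t₂ (c t₂) (R t₂) μ - LandauLifshitz.quasiLocalMomentum g t₁ (c t₁) (R t₁)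 μ| ≤ C * ∫ s in t₁..t₂, R s ^ 2 * b s ^ 2) := by
  rintro ⟨C, hC0, hPTB⟩
  -- the universal constant: `11 κ τ(S²) C`
  set κ' : ℝ := (((μHE[2] : Measure E3) (sphere (0 : E3) 1) /
    (volume : Measure E3).toSphere univ).toReal) with hκ'
  set T' : ℝ := ((volume : Measure E3).toSphere univ).toReal with hT'
  have hκ'0 : 0 ≤ κ' := ENNReal.toReal_nonneg
  refine ⟨κ' * (11 * C * T'), ?_⟩
  intro g W c R b t₁ t₂ hW hg hsymm hric _ht₁ h12 hc hR hb hkin hsph μ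
  -- the nondegenerate part of `W`
  set W' : Set E4 := W ∩ (fun x ↦ metricDet g x) ⁻¹' {0}ᶜ with hW'
  have hW'o : IsOpen W' :=
    (LLBalance.contDiffOn_metricDet hg).continuousOn.isOpen_inter_preimage hW isOpen_compl_singleton
  have hg' : ContDiffOn ℝ (⊤ : ℕ∞) g W' := hg.mono inter_subset_left
  have hdet' : ∀ x ∈ W', metricDet g x ≠ 0 := fun x hx ↦ hx.2
  -- the spheres and their points
  have hR0 : ∀ t ∈ Icc t₁ t₂, 0 < R t := fun t ht ↦ by linarith [(hkin t ht).2.2]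
  have hysph : ∀ t ∈ Icc t₁ t₂, ∀ α : sphere (0 : E3) 1,
      c t + R t • (α : E3) ∈ Metric.sphere (c t) (R t) := by
    intro t ht α
    rw [mem_sphere_iff_norm, add_sub_cancel_left, norm_smul, norm_coe_unitSphere, mul_one,
      Real.norm_of_nonneg (hR0 t ht).le]
  have hmemW' : ∀ t ∈ Icc t₁ t₂, ∀ α : sphere (0 : E3) 1,
      E4.ofTimeSpace t (c t + R t • (α : E3)) ∈ W' := by
    intro t ht α
    obtain ⟨hxW, hxη, -⟩ := hsph t ht _ (hysph t ht α)
    exact ⟨hxW, metricDet_ne_zero_of_norm_sub_minkowski_le' hxη⟩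
  -- the good times
  set G : Set ℝ := {t : ℝ | 0 < R t ∧ ∀ α : sphere (0 : E3) 1,
    E4.ofTimeSpace t (c t + R t • (α : E3)) ∈ W'} with hG
  have hGo : IsOpen G := isOpen_setOf_sphere_subset hW'o hc.continuous hR.continuous
  have hIG : Icc t₁ t₂ ⊆ G := fun t ht ↦ ⟨hR0 t ht, hmemW' t ht⟩
  -- the fields `h^{μ0j}` and the polar integrals
  set H : Fin 3 → E4 → ℝ := fun j x ↦ hField g x μ 0 j.succ with hH
  have hH1 : ∀ j, ContDiffOn ℝ 1 (H j) W' := fun j ↦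
    (LLBalance.contDiffOn_hField hW'o hg' hdet' μ 0 j.succ).of_le (WithTop.coe_le_coe.mpr le_top)
  have hRd : ∀ t, HasDerivAt R (deriv R t) t := fun t ↦
    ((hR.differentiable one_ne_zero) t).hasDerivAt
  set Q : ℝ → ℝ := fun t ↦ ∫ α : sphere (0 : E3) 1, ∑ j : Fin 3,
    H j (E4.ofTimeSpace t (c t + R t • (α : E3))) * (α : E3) j ∂(volume : Measure E3).toSphere
    with hQ
  set Q' : ℝ → ℝ := fun t ↦ ∫ α : sphere (0 : E3) 1, ∑ j : Fin 3,
    fderiv ℝ (H j) (E4.ofTimeSpace t (c t + R t • (α : E3)))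
      (E4.ofTimeSpace 1 (deriv c t + deriv R t • (α : E3))) * (α : E3) j
        ∂(volume : Measure E3).toSphere with hQ'
  set P' : ℝ → ℝ := fun t ↦ κ' * (2 * R t * deriv R t * Q t + R t ^ 2 * Q' t) with hP'
  -- (1) the momentum is differentiable on `[t₁, t₂]` with derivative `P'`
  have hderivP : ∀ t₀ ∈ Icc t₁ t₂,
      HasDerivAt (fun t ↦ quasiLocalMomentum g t (c t) (R t) μ) (P' t₀) t₀ := by
    intro t₀ ht₀
    obtain ⟨ε, hε, hball⟩ := Metric.mem_nhds_iff.1 (hGo.mem_nhds (hIG ht₀))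
    have hmem : ∀ t ∈ Icc (t₀ - ε / 2) (t₀ + ε / 2), ∀ α : sphere (0 : E3) 1,
        E4.ofTimeSpace t (c t + R t • (α : E3)) ∈ W' := by
      intro t ht α
      have htb : t ∈ ball t₀ ε := by
        rw [mem_ball, Real.dist_eq, abs_lt]
        constructor <;> linarith [ht.1, ht.2]
      exact (hball htb).2 α
    have hQd : HasDerivAt Q (Q' t₀) t₀ :=
      (hasDerivAt_integral_moving' hW'o hH1 hc hR (half_pos hε) hmem).2
    have hR2 : HasDerivAt (fun t ↦ κ' * R t ^ 2) (κ' * (2 * R t₀ * deriv R t₀)) t₀ := by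
      have h := ((hRd t₀).pow 2).const_mul κ'
      refine h.congr_deriv ?_
      push_cast
      ring
    have h3 : HasDerivAt (fun t ↦ κ' * R t ^ 2 * Q t) (P' t₀) t₀ := by
      refine (hR2.mul hQd).congr_deriv ?_
      rw [hP']
      ring
    refine h3.congr_of_eventuallyEq (eventually_of_mem (hGo.mem_nhds (hIG ht₀)) fun t ht ↦ ?_)
    exact quasiLocalMomentum_eq_toSphere' g t (c t) ht.1 μ
  -- (2) the bound `|P'| ≤ 11 κ τ(S²) C R² b²` on `[t₁, t₂]`
  have hbound : ∀ t₀ ∈ Icc t₁ t₂, |P' t₀| ≤ κ' * (11 * C * T') * (R t₀ ^ 2 * b t₀ ^ 2) := by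
    intro t₀ ht₀
    have htr := transport_identity' hW'o hg' hdet' (hR0 t₀ ht₀) (hmemW' t₀ ht₀) (deriv c t₀)
      (deriv R t₀) μ (t := t₀) (ξ := c t₀)
    -- pointwise bound on the transport integrand
    have hpt : ∀ α : sphere (0 : E3) 1,
        |(deriv R t₀ + ∑ k : Fin 3, deriv c t₀ k * (α : E3) k) *
            emComplex g (E4.ofTimeSpace t₀ (c t₀ + R t₀ • (α : E3))) μ 0 -
          ∑ j : Fin 3, emComplex g (E4.ofTimeSpace t₀ (c t₀ + R t₀ • (α : E3))) μ j.succ *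
            (α : E3) j| ≤ 11 * C * b t₀ ^ 2 := by
      intro α
      set x := E4.ofTimeSpace t₀ (c t₀ + R t₀ • (α : E3)) with hx
      have hxW' : x ∈ W' := hmemW' t₀ ht₀ α
      obtain ⟨hxW, hxη, hxb⟩ := hsph t₀ ht₀ _ (hysph t₀ ht₀ α)
      have h2 : ContDiffAt ℝ 2 g x :=
        ((hg.contDiffAt (hW.mem_nhds hxW)).of_le (WithTop.coe_le_coe.mpr le_top))
      have hsy : ∀ᶠ y in 𝓝 x, ∀ v w : E4, g y v w = g y w v :=
        eventually_of_mem (hW.mem_nhds hxW) fun y hy ↦ hsymm y hy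
      have hE : ∀ ν, |emComplex g x μ ν| ≤ C * b t₀ ^ 2 := fun ν ↦
        abs_emComplex_le_of_pseudotensor_bound (hdet' x hxW') (hric x hxW)
          (hPTB g x (b t₀) h2 hsy hxη hxb) μ ν
      exact abs_transport_integrand_le (E := fun ν ↦ emComplex g x μ ν) hC0 hE
        (hkin t₀ ht₀).2.1 (hkin t₀ ht₀).1 α
    have hI := abs_integral_toSphere_le hpt
    have hRHS : 2 * R t₀ * deriv R t₀ * Q t₀ + R t₀ ^ 2 * Q' t₀ = R t₀ ^ 2 * _ := htr
    calc |P' t₀| = κ' * |2 * R t₀ * deriv R t₀ * Q t₀ + R t₀ ^ 2 * Q' t₀| := by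
          rw [hP', abs_mul, abs_of_nonneg hκ'0]
      _ = κ' * (R t₀ ^ 2 * |∫ α : sphere (0 : E3) 1,
          ((deriv R t₀ + ∑ k : Fin 3, deriv c t₀ k * (α : E3) k) *
            emComplex g (E4.ofTimeSpace t₀ (c t₀ + R t₀ • (α : E3))) μ 0 -
          ∑ j : Fin 3, emComplex g (E4.ofTimeSpace t₀ (c t₀ + R t₀ • (α : E3))) μ j.succ *
            (α : E3) j) ∂(volume : Measure E3).toSphere|) := by
          rw [hRHS, abs_mul, abs_of_nonneg (sq_nonneg _)]
      _ ≤ κ' * (R t₀ ^ 2 * (11 * C * b t₀ ^ 2 * T')) := by gcongr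
      _ = κ' * (11 * C * T') * (R t₀ ^ 2 * b t₀ ^ 2) := by ring
  -- (3) integrate: fencing by `B(t) = C' ∫_{t₁}^t R² b̃²` with the continuous extension `b̃` of `b`
  set bt : ℝ → ℝ := fun s ↦ b (max t₁ (min s t₂)) with hbt
  have hclamp : ∀ s, max t₁ (min s t₂) ∈ Icc t₁ t₂ := fun s ↦
    ⟨le_max_left _ _, max_le h12 (min_le_right _ _)⟩
  have hbtc : Continuous bt :=
    hb.comp_continuous (continuous_const.max (continuous_id.min continuous_const)) hclamp
  have hbt_eq : ∀ s ∈ Icc t₁ t₂, bt s = b s := fun s hs ↦ by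
    simp only [hbt, min_eq_left hs.2, max_eq_right hs.1]
  set φ : ℝ → ℝ := fun s ↦ κ' * (11 * C * T') * (R s ^ 2 * bt s ^ 2) with hφ
  have hφc : Continuous φ := continuous_const.mul ((hR.continuous.pow 2).mul (hbtc.pow 2))
  set B : ℝ → ℝ := fun t ↦ ∫ s in t₁..t, φ s with hB
  have hBd : ∀ t, HasDerivAt B (φ t) t := fun t ↦ (hφc.integral_hasStrictDerivAt t₁ t).hasDerivAt
  have hfence := image_norm_le_of_norm_deriv_right_le_deriv_boundary
    (f := fun t ↦ quasiLocalMomentum g t (c t) (R t) μ - quasiLocalMomentum g t₁ (c t₁) (R t₁) μ)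
    (f' := P') (a := t₁) (b := t₂) (B := B) (B' := φ) ?_ ?_ ?_ hBd ?_
  · have h := hfence (right_mem_Icc.2 h12)
    rw [Real.norm_eq_abs] at h
    refine h.trans (le_of_eq ?_)
    simp only [hB, hφ]
    rw [intervalIntegral.integral_const_mul]
    congr 1
    refine intervalIntegral.integral_congr fun s hs ↦ ?_
    rw [uIcc_of_le h12] at hs
    simp only [hbt_eq s hs]
  · intro t ht
    exact ((hderivP t ht).sub_const _).continuousAt.continuousWithinAt
  · intro t ht
    exact ((hderivP t (Ico_subset_Icc_self ht)).sub_const _).hasDerivWithinAt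
  · simp [hB]
  · intro t ht
    rw [Real.norm_eq_abs, hφ]
    simp only [hbt_eq t (Ico_subset_Icc_self ht)]
    exact hbound t (Ico_subset_Icc_self ht)

/-- Registered one-line form (carrier `abs_apply_le_norm_E3_sce12` of the crux item stmt-FinalStateConjecture-17403) of
`abs_apply_le_norm_E3`. [folklore] -/
theorem abs_apply_le_norm_E3_sce12 : open Literature.Geometry.Lorentzian in ∀ (v : E3) (k : Fin 3), |v k| ≤ ‖v‖ :=
  fun v k ↦ Literature.Barriers.FinalStateConjecture.abs_apply_le_norm_E3 v k

end Summit.FinalStateConjecture.FinalStateConjecture.Theorems.SublinearIsFree.WindowCharges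

end
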